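import Summits.ResolutionOfSingularities.ResolutionOfSingularities.Theorems.HilbertSamuelEliminationSigmaMaxModificationsCorridor3SigmaIsoBoundaryDefs
import Summits.ResolutionOfSingularities.ResolutionOfSingularities.Theorems.HilbertSamuelEliminationSigmaMaxModificationsCorridor3SigmaIsoReaches
import HarnessLib

/-!
# [OURS · L1 W4.2] σ-LAYER — `Corridor3SigmaIsoBoundaryReaches`: MAXIMAL ORIGINS ALONG BOUNDARY-THREADED σ-REACHES, waiting links, and THE KERNEL AT AN
# ISOLATED STAGE for an arbitrary admissible (functional) BOUNDARY-READING strategy `σ : StrategyE` — part 1/2 of «THE ISOLATED KERNEL IS STRATEGY-FREE»,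
# E-threaded (res-L1-w42-plan-1 RULING v3.14-12a (BR-10); W4.2 DEAL D16-σ, RULINGS v3.14-11a (CP); crux chain w42 `SigmaMaxModificationsCorridor3`
# stmt-ResolutionOfSingularities-19249 / crux stmt-…-18506; `--supports stmt-ResolutionOfSingularities-19249 --as helper`, counted 0)

HONEST FRAMING. OURS proof file (theorem-only, no new definition, fact-free — CJS Thm. 3.10 (1) enters as the tree's PROVED `IsBlowup.hsFun_le_of_isPermissible`,
excellence over a field as the tree's PROVED `Stacks07QW_field_holds`); NOTHING here is a statement of H. Hironaka's manuscript [Hironaka2017] nor of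
Cossart–Jannsen–Saito. Every `theorem` is the E-COPY (o1's `MarkedStageE` / `CanonicalNearStepσE` / `ReachesσE` / `IsBlownUpσE` / `InScopeMσE … E₀`, admissibility
`IsAdmissibleStrategyOnE (StrategyE.ReachableState p σ N ν E₀)`, functionality `StrategyE.IsFunctional`) of the BLIND theorem of the same name without `E` in
`…Corridor3SigmaIsoReaches` (p525402), SAME proof; plus the two unpacking lemmas `IsAdmissibleStrategyOnE.step_specE` / `.exists_stepE` (E-copies of 047's).
THE POINT, now for boundary-reading strategies: at an ISOLATED marked point EVERY centre an admissible σ allows through the point is `𝔪` at the point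
(`stalkIdeal_centre_eq_maximalIdeal_of_isoσE`) — whatever σ reads, boundary included. AI-written; AI review is weaker than expert review.

## Contents (namespace `…Theorems.SigmaMaxModificationsCorridor3.Sigma`)

* §1 bookkeeping along `ReachesσE` (no admissibility): `CanonicalNearStepσE.isClosed_pt/pt_mem_hsStratum`, `ReachesσE.isClosed_pt`, `pt_mem_hsStratum_of_reachesσE`,
  `exists_overField_separated_of_canonicalNearStepσE/_of_reachesσE`, `canonicalNearStepσE_dim_le`, `dim_le_of_reachesσE`, `inScopeMσE_of_reachesσE`,
  `StrategyE.reachableState_of_inScopeMσE`, `IsAdmissibleStrategyOnE.step_specE/exists_stepE`.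
* §2 **`IsMaximalOrigin.of_reachesσE`** (+ one-step `IsMaximalOrigin.of_canonicalNearStepσE_of_isPermissible`, `InScopeMσE.isMaximalOrigin`).
* §3 waiting links `nonempty_stalkIso_of_stepσE_of_not_isBlownUpσE`, `nonempty_stalkIso_of_waitingσE`.
* §4 **`stalkIdeal_centre_eq_maximalIdeal_of_isoσE`**, `exists_genuineStep_of_isoσE` (functional σ).

## References (context only)

* V. Cossart, U. Jannsen, S. Saito, LNM 2270 (2020): Thm. 3.10 (1), Cor. 3.12, Def. 3.1, Def. 6.34, Def. 13.3, Rem. 6.29 (1). [CossartJannsenSaito2020]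
* U. Görtz, T. Wedhorn, *Algebraic Geometry I* (2nd ed. 2020), Prop. 13.91, Prop. 13.96. [GortzWedhorn2020]
-/

noncomputable section

set_option linter.dupNamespace false -- mandated namespace of this single-conjunct summit

open CategoryTheory CategoryTheory.Limits AlgebraicGeometry TopologicalSpace IsLocalRing
open Literature.AlgebraicGeometry.Resolution Literature.RingTheory.HilbertSamuel
open Scheme.IdealSheafData
open Literature.AlgebraicGeometry.CossartJannsenSaito2020
open Summit.ResolutionOfSingularities.ResolutionOfSingularities.Theorems.CampaignW42
open Summit.ResolutionOfSingularities.ResolutionOfSingularities.Theorems.SigmaMaxModificationsCorridor3.Moving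
open Summit.ResolutionOfSingularities.ResolutionOfSingularities.Theorems.SigmaMaxModificationsCorridor3.Helpers (QPointed)
open Summit.ResolutionOfSingularities.ResolutionOfSingularities.Cruxes.SigmaMaxModifications.IdeasL1Idea2R4

namespace Summit.ResolutionOfSingularities.ResolutionOfSingularities.Theorems.SigmaMaxModificationsCorridor3.Sigma

universe u

variable {p : ℕ} {σ : StrategyE.{u}} {N : ℕ} {ν : ℕ → ℕ} {E₀ : ∀ (X : Scheme.{u}), X → Boundary X}

/-! ## §1. Bookkeeping along σ-reaches (no admissibility needed) -/

/-- The next marked point of a σ-near step is closed (by the step clause). [folklore] -/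
theorem CanonicalNearStepσE.isClosed_pt {s s' : MarkedStageE.{u}} (h : CanonicalNearStepσE σ N ν s s') :
    IsClosed ({s'.pt} : Set s'.W) := by
  obtain ⟨C, P', hln, x', -, -, hcl, -, rfl⟩ := h
  exact hcl

/-- The next marked point of a σ-near step lies in the `ν`-stratum (by the step clause). [folklore] -/
theorem CanonicalNearStepσE.pt_mem_hsStratum {s s' : MarkedStageE.{u}} (h : CanonicalNearStepσE σ N ν s s') :
    s'.pt ∈ Scheme.hsStratum s'.W N ν := by
  obtain ⟨C, P', hln, x', -, -, -, hx', rfl⟩ := h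
  exact hx'

/-- The marked point of a stage σ-reached from a closed point is closed. [folklore] -/
theorem ReachesσE.isClosed_pt {s₀ s : MarkedStageE.{u}} (hs : ReachesσE σ N ν s₀ s) (h0 : IsClosed ({s₀.pt} : Set s₀.W)) :
    IsClosed ({s.pt} : Set s.W) := by
  induction hs with
  | refl => exact h0
  | tail _ hlast _ => exact hlast.isClosed_pt

/-- Along σ-reaches from a marked point of the `ν`-stratum, the marked point stays in the `ν`-stratum. [folklore] -/
theorem pt_mem_hsStratum_of_reachesσE {s₀ s : MarkedStageE.{u}} (hs : ReachesσE σ N ν s₀ s)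
    (h0 : s₀.pt ∈ Scheme.hsStratum s₀.W N ν) : s.pt ∈ Scheme.hsStratum s.W N ν := by
  induction hs with
  | refl => exact h0
  | tail _ hlast _ => exact hlast.pt_mem_hsStratum

/-- Separated finite type over a field propagates along a σ-near step (the blow-down map of a blow-up of a locally noetherian scheme is
proper). [cite: GortzWedhorn2020, Prop. 13.96 (1)] -/
theorem exists_overField_separated_of_canonicalNearStepσE {k : Type u} [Field k] {s s' : MarkedStageE.{u}}
    (h : ∃ f : s.W ⟶ Spec (.of k), IsSeparated f ∧ LocallyOfFiniteType f ∧ QuasiCompact f)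
    (hst : CanonicalNearStepσE σ N ν s s') :
    ∃ f : s'.W ⟶ Spec (.of k), IsSeparated f ∧ LocallyOfFiniteType f ∧ QuasiCompact f := by
  obtain ⟨C, P', hln, x', -, -, -, -, rfl⟩ := hst
  obtain ⟨f, hf, hft, hq⟩ := h
  haveI := s.ln
  haveI : IsProper (blowup.π C) := (blowup.isBlowup C).isProper
  exact ⟨blowup.π C ≫ f, inferInstance, inferInstance, inferInstance⟩

/-- … and along `ReachesσE`. [folklore] -/
theorem exists_overField_separated_of_reachesσE {k : Type u} [Field k] {s s' : MarkedStageE.{u}}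
    (h : ∃ f : s.W ⟶ Spec (.of k), IsSeparated f ∧ LocallyOfFiniteType f ∧ QuasiCompact f)
    (hr : ReachesσE σ N ν s s') :
    ∃ f : s'.W ⟶ Spec (.of k), IsSeparated f ∧ LocallyOfFiniteType f ∧ QuasiCompact f := by
  induction hr with
  | refl => exact h
  | tail _ hlast ih => exact exists_overField_separated_of_canonicalNearStepσE ih hlast

/-- A σ-near step does not raise the dimension of the stage (blow-ups of locally noetherian schemes). [cite: GortzWedhorn2020, Prop. 13.91] -/
theorem canonicalNearStepσE_dim_le {s s' : MarkedStageE.{u}} (h : CanonicalNearStepσE σ N ν s s') {d : ℕ}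
    (hd : topologicalKrullDim s.W ≤ (d : WithBot ℕ∞)) : topologicalKrullDim s'.W ≤ (d : WithBot ℕ∞) := by
  obtain ⟨C, P', h', x', -, -, -, -, rfl⟩ := h
  haveI := s.ln
  exact (blowup.isBlowup C).topologicalKrullDim_le_of_isLocallyNoetherian hd

/-- Along `ReachesσE` the dimension of the stages does not go up. [folklore] -/
theorem dim_le_of_reachesσE {s₀ s : MarkedStageE.{u}} (h : ReachesσE σ N ν s₀ s) {d : ℕ}
    (hd : topologicalKrullDim s₀.W ≤ (d : WithBot ℕ∞)) : topologicalKrullDim s.W ≤ (d : WithBot ℕ∞) := by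
  induction h with
  | refl => exact hd
  | tail _ hlast ih => exact canonicalNearStepσE_dim_le hlast ih

/-- A stage σ-reached from a maximal origin is in σ-scope. [folklore] -/
theorem inScopeMσE_of_reachesσE {X : Scheme.{u}} [IsLocallyNoetherian X] {x : X} (hX : IsMaximalOrigin p N ν X x)
    {s : MarkedStageE.{u}} (hs : ReachesσE σ N ν (MarkedStageE.init X x (E₀ X x)) s) : InScopeMσE p σ N ν E₀ s :=
  ⟨X, inferInstance, x, hX, hs⟩

/-- The state of a σ-reachable boundary-threaded marked stage is a reachable state (E-copy of 047's `Strategy.reachableState_of_inScopeMσ`). [folklore] -/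
theorem StrategyE.reachableState_of_inScopeMσE {s : MarkedStageE.{u}} (hs : InScopeMσE p σ N ν E₀ s) :
    StrategyE.ReachableState p σ N ν E₀ s.W s.ln s.L s.P s.E :=
  ⟨s.pt, hs⟩

/-- On a reachable boundary-threaded state every step a `ReachableState`-admissible σ allows has a permissible centre inside the `ν`-stratum, non-empty
while the stratum is (clause (a) of o1's `IsAdmissibleStrategyOnE` unpacked at a marked stage; E-copy of 047's `IsAdmissibleStrategyOn.step_spec`).
[folklore] -/
theorem IsAdmissibleStrategyOnE.step_specE (h : IsAdmissibleStrategyOnE (StrategyE.ReachableState p σ N ν E₀) N ν σ)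
    {s : MarkedStageE.{u}} (hs : InScopeMσE p σ N ν E₀ s) {C : s.W.IdealSheafData} {P' : Option (Pending (blowup C))}
    (hstep : σ.step s.W s.ln N ν s.L s.P s.E C P') :
    IdealSheafData.IsPermissible C ∧ (C.support : Set s.W) ⊆ Scheme.hsStratum s.W N ν ∧
      ((Scheme.hsStratum s.W N ν).Nonempty → (C.support : Set s.W).Nonempty) :=
  (h s.W s.ln s.L s.P s.E (StrategyE.reachableState_of_inScopeMσE hs)).1 C P' hstep

/-- … and TOTALITY: on a reachable boundary-threaded state with non-empty `ν`-stratum σ allows some step (clause (b)). [folklore] -/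
theorem IsAdmissibleStrategyOnE.exists_stepE (h : IsAdmissibleStrategyOnE (StrategyE.ReachableState p σ N ν E₀) N ν σ)
    {s : MarkedStageE.{u}} (hs : InScopeMσE p σ N ν E₀ s) (hne : (Scheme.hsStratum s.W N ν).Nonempty) :
    ∃ (C : s.W.IdealSheafData) (P' : Option (Pending (blowup C))), σ.step s.W s.ln N ν s.L s.P s.E C P' :=
  (h s.W s.ln s.L s.P s.E (StrategyE.reachableState_of_inScopeMσE hs)).2 hne

/-! ## §2. Every stage σ-reached from a maximal origin is a maximal origin (σ admissible on the marked scope) -/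

/-- **ONE ADMISSIBLE σ-STEP FROM A MAXIMAL ORIGIN LANDS AT A MAXIMAL ORIGIN.** If `(s.W, s.pt)` is a maximal origin of characteristic `p`
at level `N`, value `ν`, and `s → s'` is a σ-near step whose centre is PERMISSIBLE, then `(s'.W, s'.pt)` is again a maximal origin: the
blow-up is reduced (`IsBlowup.isReduced_of_isReduced`), separated of finite type over the same field (proper blow-down), of dimension `≤ N`,
`ν` is never exceeded on it (`H^N` does not increase under a permissible blow-up of an excellent scheme — CJS Thm. 3.10 (1), tree-proved
`IsBlowup.hsFun_le_of_isPermissible`) and is attained at the closed marked point `x' ∈ X'(ν)`. [cite: CossartJannsenSaito2020, Thm. 3.10 (1), Cor. 3.12] -/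
theorem _root_.Summit.ResolutionOfSingularities.ResolutionOfSingularities.Theorems.CampaignW42.IsMaximalOrigin.of_canonicalNearStepσE_of_isPermissible {s s' : MarkedStageE.{u}} (hO : IsMaximalOrigin p N ν s.W s.pt)
    {C : s.W.IdealSheafData} {P' : Option (Pending (blowup C))} {h : IsLocallyNoetherian (blowup C)} {x' : ↥(blowup C)}
    (hperm : IdealSheafData.IsPermissible C) (hcl : IsClosed ({x'} : Set ↥(blowup C)))
    (hx' : x' ∈ Scheme.hsStratum (blowup C) N ν) (he : s' = ⟨⟨blowup C, h, s.L.next (Scheme.hsStratum s.W N ν) C, P', x'⟩, s.E.next C⟩) :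
    IsMaximalOrigin p N ν s'.W s'.pt := by
  subst he
  haveI : IsLocallyNoetherian s.W := s.ln
  haveI : IsReduced s.W := hO.isReduced
  obtain ⟨k, _, _, f, hsep, hft, hqc⟩ := hO.exists_structure
  haveI := hsep
  haveI := hft
  haveI := hqc
  haveI : IsProper (blowup.π C) := (blowup.isBlowup C).isProper
  have hexc : Scheme.IsExcellent s.W := Scheme.isExcellent_of_locallyOfFiniteType Stacks07QW_field_holds f
  have hsup : ∀ w : s.W, ν ≤ Scheme.hsFun s.W N w → Scheme.hsFun s.W N w = ν :=
    fun w hw => le_antisymm (hO.maximal.2 ⟨w, rfl⟩ hw) hw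
  have hsup' : ∀ z : ↥(blowup C), ν ≤ Scheme.hsFun (blowup C) N z → Scheme.hsFun (blowup C) N z = ν := by
    intro z hz
    have hle := (blowup.isBlowup C).hsFun_le_of_isPermissible hexc hperm N z
    have heq := hsup _ (hz.trans hle)
    exact le_antisymm (heq ▸ hle) hz
  exact
    { exists_structure := ⟨k, ‹_›, ‹_›, blowup.π C ≫ f, inferInstance, inferInstance, inferInstance⟩
      isReduced := (blowup.isBlowup C).isReduced_of_isReduced
      dim_le := (blowup.isBlowup C).topologicalKrullDim_le_of_isLocallyNoetherian hO.dim_le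
      maximal := maximal_hsValues_of_supMax hsup' hx'
      isClosed := hcl
      mem_stratum := hx' }

/-- **EVERY STAGE σ-REACHED FROM A MAXIMAL ORIGIN IS A MAXIMAL ORIGIN** for the same `p`, `N`, `ν`, at its marked point, when σ is
ADMISSIBLE on the marked scope `Strategy.ReachableState p σ N ν` (so that every centre met on the way is permissible — clause (a)(i)) —
the σ-port of res-type-071's `IsMaximalOrigin.of_reaches`. [cite: CossartJannsenSaito2020, Cor. 3.12, Rem. 6.29 (1)] -/
theorem _root_.Summit.ResolutionOfSingularities.ResolutionOfSingularities.Theorems.CampaignW42.IsMaximalOrigin.of_reachesσE (hadm : IsAdmissibleStrategyOnE (StrategyE.ReachableState p σ N ν E₀) N ν σ)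
    {X : Scheme.{u}} [IsLocallyNoetherian X] {x : X} (hX : IsMaximalOrigin p N ν X x) {s : MarkedStageE.{u}}
    (hs : ReachesσE σ N ν (MarkedStageE.init X x (E₀ X x)) s) : IsMaximalOrigin p N ν s.W s.pt := by
  induction hs with
  | refl => exact hX
  | tail hprev hlast ih =>
    obtain ⟨C, P', hln, x', hstep, -, hcl, hx', he⟩ := hlast
    have hperm : IdealSheafData.IsPermissible C := (hadm.step_specE (inScopeMσE_of_reachesσE hX hprev) hstep).1
    exact ih.of_canonicalNearStepσE_of_isPermissible hperm hcl hx' he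

/-- In-σ-scope stages ARE maximal origins (σ admissible on the marked scope). [folklore] -/
theorem InScopeMσE.isMaximalOrigin (hadm : IsAdmissibleStrategyOnE (StrategyE.ReachableState p σ N ν E₀) N ν σ)
    {s : MarkedStageE.{u}} (hs : InScopeMσE p σ N ν E₀ s) : IsMaximalOrigin p N ν s.W s.pt := by
  obtain ⟨X, hX, x, horig, hreach⟩ := hs
  exact horig.of_reachesσE hadm hreach

/-! ## §3. Waiting steps and waiting segments identify the local rings at the marked points -/

/-- **A WAITING σ-step identifies the local rings at the marked points**: if NO step σ allows from the state of `s` has a centre through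
`x_n` (¬ `IsBlownUpσE`), in particular the chain's own step does not, the blow-up is an isomorphism near `x_{n+1}` (tree `IsBlowup.isIso_compl`,
`isIso_stalkMap_of_isIso_morphismRestrict`). σ-port of `nonempty_stalkIso_of_step_of_not_isBlownUp`. [cite: GortzWedhorn2020, Prop. 13.91 (3)] -/
theorem nonempty_stalkIso_of_stepσE_of_not_isBlownUpσE {s s' : MarkedStageE.{u}} (hst : CanonicalNearStepσE σ N ν s s')
    (hnb : ¬ s.IsBlownUpσE σ N ν) : Nonempty (s.W.presheaf.stalk s.pt ≅ s'.W.presheaf.stalk s'.pt) := by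
  haveI : IsLocallyNoetherian s.W := s.ln
  obtain ⟨C, P', hln, x', hcs, hπ, -, -, rfl⟩ := hst
  have hnot : (blowup.π C).base x' ∉ (C.support : Set s.W) := fun h => hnb ⟨C, P', hcs, hπ ▸ h⟩
  haveI := (blowup.isBlowup C).isIso_compl
  haveI := isIso_stalkMap_of_isIso_morphismRestrict (blowup.π C)
    ⟨(C.support : Set s.W)ᶜ, C.support.isClosed.isOpen_compl⟩ x' hnot
  exact ⟨eqToIso (by rw [← hπ]) ≪≫ asIso ((blowup.π C).stalkMap x')⟩

/-- **A waiting SEGMENT of a σ-chain identifies the local rings**: if no stage `m` with `a ≤ m < b` is blown up (σ-sense) along the chain,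
then `𝒪_{X_a,x_a} ≅ 𝒪_{X_b,x_b}`. σ-port of `nonempty_stalkIso_of_waiting`. [folklore] -/
theorem nonempty_stalkIso_of_waitingσE {c : ℕ → MarkedStageE.{u}} (hstep : ∀ n, CanonicalNearStepσE σ N ν (c n) (c (n + 1)))
    {a b : ℕ} (hab : a ≤ b) (hw : ∀ m, a ≤ m → m < b → ¬ (c m).IsBlownUpσE σ N ν) :
    Nonempty ((c a).W.presheaf.stalk (c a).pt ≅ (c b).W.presheaf.stalk (c b).pt) := by
  induction b, hab using Nat.le_induction with
  | base => exact ⟨Iso.refl _⟩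
  | succ b hab ih =>
    obtain ⟨e⟩ := ih fun m hm hmb => hw m hm (Nat.lt_succ_of_lt hmb)
    obtain ⟨e'⟩ := nonempty_stalkIso_of_stepσE_of_not_isBlownUpσE (hstep b) (hw b hab (Nat.lt_succ_self b))
    exact ⟨e ≪≫ e'⟩

/-! ## §4. THE KERNEL AT AN ISOLATED STAGE: an admissible centre through an isolated marked point is the point -/

/-- **AT AN ISOLATED MARKED POINT EVERY ADMISSIBLE CENTRE THROUGH THE POINT IS `𝔪` AT THE POINT** (THE POINT of RULINGS v3.14-11a (CP);
σ-port of res-L1-w42-stub-1's `IsMaximalOrigin.stalkIdeal_centre_eq_maximalIdeal_of_iso`): at a stage `s` σ-reached from a maximal origin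
(σ admissible on the marked scope) whose marked point `x_n` is isolated in the Hilbert–Samuel locus (`Moving.Iso N s`), every centre `C` of a
step σ ALLOWS from the state of `s` with `x_n ∈ V(C)` has `C_{x_n} = 𝔪_{x_n}`: `C` is permissible (prime stalk, admissibility (a)(i)) and
supported in `X_n(ν) ⊆ (X_n)_max` (admissibility (a)(ii); `ν` is maximal on the reached stage by §2), which an open neighbourhood of `x_n`
meets only in `x_n`. So locally at `x_n` the genuine step of ANY admissible σ is the blow-up of the point.
[cite: CossartJannsenSaito2020, Def. 13.3, Def. 6.34 (i), Def. 3.1] -/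
theorem stalkIdeal_centre_eq_maximalIdeal_of_isoσE (hadm : IsAdmissibleStrategyOnE (StrategyE.ReachableState p σ N ν E₀) N ν σ)
    {X : Scheme.{u}} [IsLocallyNoetherian X] {x : X} (hX : IsMaximalOrigin p N ν X x) {s : MarkedStageE.{u}}
    (hs : ReachesσE σ N ν (MarkedStageE.init X x (E₀ X x)) s) (hiso : Iso N s.toMarkedStage) {C : s.W.IdealSheafData}
    {P' : Option (Pending (blowup C))} (hst : σ.step s.W s.ln N ν s.L s.P s.E C P') (hmem : s.pt ∈ (C.support : Set s.W)) :
    stalkIdeal C s.pt = maximalIdeal (s.W.presheaf.stalk s.pt) := by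
  haveI : IsLocallyNoetherian s.W := s.ln
  obtain ⟨hperm, hsub, -⟩ := hadm.step_specE (inScopeMσE_of_reachesσE hX hs) hst
  have hO : IsMaximalOrigin p N ν s.W s.pt := hX.of_reachesσE hadm hs
  obtain ⟨U, hU, hUmax⟩ := hiso
  have hvU : s.pt ∈ U := by
    have : s.pt ∈ U ∩ Scheme.hsMaxLocus s.W N := by rw [hUmax]; exact Set.mem_singleton _
    exact this.1
  refine stalkIdeal_eq_maximalIdeal_of_support_inter_subset_singleton C
    (isPrime_stalkIdeal_of_isPermissibleAt (hperm s.pt hmem)) hU hvU ?_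
  rintro w ⟨hwC, hwU⟩
  have hwmax : w ∈ Scheme.hsMaxLocus s.W N := hO.hsStratum_subset_hsMaxLocus (hsub hwC)
  have : w ∈ U ∩ Scheme.hsMaxLocus s.W N := ⟨hwU, hwmax⟩
  rwa [hUmax] at this

/-- **THE GENUINE σ-STEP at a blown-up ISOLATED marked point** (σ FUNCTIONAL and admissible on the marked scope; σ-port of res-D-pv-042's
`Moving.exists_genuineStep_of_iso`): THE centre `C` of the chain's step — equal, by functionality, to the centre through `x_n` that
`IsBlownUpσE` provides — is the reduced structure on its support (permissible ⇒ regular ⇒ `C = 𝓘(V(C))`), `C_{x_n} = 𝔪_{x_n}` (§4), and the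
next marked point is a closed point `x'` of `Bℓ_C(X_n)` over `x_n` with `𝒪_{Bℓ_C(X_n),x'} = 𝒪_{X_{n+1},x_{n+1}}`.
[cite: CossartJannsenSaito2020, Def. 13.3, Def. 6.34 (i), Rem. 6.29 (1)] -/
theorem exists_genuineStep_of_isoσE (hfun : σ.IsFunctional N ν)
    (hadm : IsAdmissibleStrategyOnE (StrategyE.ReachableState p σ N ν E₀) N ν σ) {X : Scheme.{u}} [IsLocallyNoetherian X] {x : X}
    (hX : IsMaximalOrigin p N ν X x) {s s' : MarkedStageE.{u}} (hreach : ReachesσE σ N ν (MarkedStageE.init X x (E₀ X x)) s)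
    (hst : CanonicalNearStepσE σ N ν s s') (hb : s.IsBlownUpσE σ N ν) (hiso : Iso N s.toMarkedStage) :
    ∃ (C : s.W.IdealSheafData) (x' : ↥(blowup C)),
      C = vanishingIdeal C.support ∧ stalkIdeal C s.pt = @maximalIdeal (s.W.presheaf.stalk s.pt) _ _ ∧
        (blowup.π C).base x' = s.pt ∧ IsClosed ({x'} : Set ↥(blowup C)) ∧
          Nonempty ((blowup C).presheaf.stalk x' ≅ s'.W.presheaf.stalk s'.pt) := by
  haveI : IsLocallyNoetherian s.W := s.ln
  obtain ⟨C, P', hcs, hmem⟩ := hb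
  have hmax : stalkIdeal C s.pt = maximalIdeal (s.W.presheaf.stalk s.pt) :=
    stalkIdeal_centre_eq_maximalIdeal_of_isoσE hadm hX hreach hiso hcs hmem
  obtain ⟨C₂, P₂', hln, x', hcs₂, hπ, hcl, -, rfl⟩ := hst
  obtain rfl : C = C₂ := (hfun s.W s.ln s.L s.P s.E).1 C C₂ P' P₂' hcs hcs₂
  have hperm : IdealSheafData.IsPermissible C := (hadm.step_specE (inScopeMσE_of_reachesσE hX hreach) hcs).1
  have hreg : Scheme.IsRegular C.subscheme := isRegular_subscheme_of_isPermissible hperm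
  exact ⟨C, x', eq_vanishingIdeal_support_of_isRegular C hreg, hmax, hπ, hcl, ⟨Iso.refl _⟩⟩

end Summit.ResolutionOfSingularities.ResolutionOfSingularities.Theorems.SigmaMaxModificationsCorridor3.Sigma

end
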